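import Mathlib
import Summits.Ventures.PercRepro2.PairHarris
import Summits.Ventures.PercRepro2.TB14CutCase2

/-!
# Typed Harris with a decreasing spectator on the second copy
(blind cell PercRepro2, mine-c g15, 2026-08-25; `proofs/MINEC-TB14BLOCK.md` §8)

`DAD.fibreHarris` allows the up-set of the first copy to be ANY up-set of red free sets, in
particular one that also reads the second copy through its complement: the event
`{b ∈ C_y(a)} ∩ {x ∉ C_ȳ(a)}` is increasing in the red free set (`y` grows, `ȳ` shrinks).  Hence
(`pairCount_harris_cross`) for up-sets `𝒰` of red sets and `B` of configurations,
`N(𝒰, B) ≤ N(𝒰 ∩ B, Ω)`, and (`pairCount_half_second_copy`)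

  `#{y : b ∈ C_y(a), x ∉ C_ȳ(a), c ∈ C_ȳ(a)} ≤ #{y : b ∈ C_y(a), x ∉ C_ȳ(a), c ∈ C_y(a)}`

— the half `H2` of the candidate lemma (MID) is a theorem; the other half `H1` (the avoidance on the
FIRST copy) is not monotone and is unsigned in the census.  Own work; standard axioms.
-/

namespace Summit.Ventures.PercRepro2

namespace PairHarris

open CovForm A3InactiveTyped

section Cross

variable {E : Type*} [Fintype E] [DecidableEq E] {R : Type*} [Field R] [LinearOrder R]
  [IsStrictOrderedRing R]

/-- **Typed Harris with an up-set of red sets**: for an up-set `𝒰` of red free sets (read on the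
first copy, possibly through the complement on the second) and an up-set `B` of configurations,
the cross count is at most the same-copy count. -/
theorem pairCount_harris_cross (F : Finset E) (z : Config E) (𝒰 : Set (Finset E))
    (h𝒰 : IsUpperSet 𝒰) (B : Set (Config E)) (hB : IsUpperSet B) :
    pairCount F z (fun y w => 𝒰.indicator (1 : Finset E → R) (pinnedOpen F z ∪ freeOf F y) *
        B.indicator 1 w) ≤
      pairCount F z (fun y _ => 𝒰.indicator (1 : Finset E → R) (pinnedOpen F z ∪ freeOf F y) *
        B.indicator 1 y) := by
  rw [pairCount_eq_sum_powerset, pairCount_eq_sum_powerset]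
  let 𝒱 : Set (Finset E) := {X | ofSet X ∈ B}
  have h𝒱 : IsUpperSet 𝒱 := fun X Y hXY hX => hB (ofSet_mono hXY) hX
  have key := DAD.fibreHarris (R := R) F (pinnedOpen F z) (pinnedOpen F z)
    (disjoint_pinnedOpen F z) (disjoint_pinnedOpen F z) 𝒰 𝒱 h𝒰 h𝒱
  have hl : ∀ r ∈ F.powerset,
      𝒰.indicator (1 : Finset E → R) (pinnedOpen F z ∪ freeOf F (ofSet (pinnedOpen F z ∪ r))) *
        B.indicator 1 (ofSet (pinnedOpen F z ∪ (F \ r))) =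
      𝒰.indicator (1 : Finset E → R) (pinnedOpen F z ∪ r) *
        𝒱.indicator 1 (pinnedOpen F z ∪ (F \ r)) := by
    intro r hr
    rw [freeOf_ofSet (z := z) (Finset.mem_powerset.1 hr)]
    rfl
  have hr : ∀ r ∈ F.powerset,
      𝒰.indicator (1 : Finset E → R) (pinnedOpen F z ∪ freeOf F (ofSet (pinnedOpen F z ∪ r))) *
        B.indicator 1 (ofSet (pinnedOpen F z ∪ r)) =
      (𝒰 ∩ 𝒱).indicator (1 : Finset E → R) (pinnedOpen F z ∪ pinnedOpen F z ∪ r) := by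
    intro r hr
    rw [freeOf_ofSet (z := z) (Finset.mem_powerset.1 hr), Finset.union_self,
      Set.inter_indicator_one, Pi.mul_apply]
    rfl
  calc _ = ∑ r ∈ F.powerset, 𝒰.indicator (1 : Finset E → R) (pinnedOpen F z ∪ r) *
          𝒱.indicator 1 (pinnedOpen F z ∪ (F \ r)) := Finset.sum_congr rfl hl
    _ ≤ ∑ r ∈ F.powerset,
          (𝒰 ∩ 𝒱).indicator (1 : Finset E → R) (pinnedOpen F z ∪ pinnedOpen F z ∪ r) := key
    _ = _ := (Finset.sum_congr rfl hr).symm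

variable {V : Type*}

/-- The up-set of red sets «`b ∈ C(a)` in the first copy and `x ∉ C(a)` in the second». -/
lemma isUpperSet_cross (ends : E → Sym2 V) (a b x : V) (F : Finset E) (z : Config E) :
    IsUpperSet {X : Finset E | Conn ends (ofSet X) a b ∧
      ¬ Conn ends (ofSet (pinnedOpen F z ∪ (F \ X))) a x} := by
  intro X Y hXY hX
  refine ⟨conn_mono (ofSet_mono hXY) hX.1, fun h => hX.2 (conn_mono (ofSet_mono ?_) h)⟩
  exact Finset.union_subset_union_right (Finset.sdiff_subset_sdiff le_rfl hXY)

omit [LinearOrder R] [IsStrictOrderedRing R] in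
/-- On an admissible first copy, the cross up-set is `1[b ∈ C_y(a)] · (1 − 1[x ∈ C_ȳ(a)])`. -/
lemma indicator_cross_eq (ends : E → Sym2 V) (a b x : V) (F : Finset E) (z : Config E)
    (y : Config E) (hy : ∀ e, e ∉ F → y e = z e) :
    ({X : Finset E | Conn ends (ofSet X) a b ∧
        ¬ Conn ends (ofSet (pinnedOpen F z ∪ (F \ X))) a x}.indicator (1 : Finset E → R)
      (pinnedOpen F z ∪ freeOf F y)) =
      iL ends a b y * (1 - iL ends a x (A3InactiveTyped.flipOn F y)) := by
  classical
  have h1 : ofSet (pinnedOpen F z ∪ freeOf F y) = y := ofSet_freeOf hy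
  have h3 : F \ (pinnedOpen F z ∪ freeOf F y) = F \ freeOf F y := by
    ext e
    simp only [Finset.mem_sdiff, Finset.mem_union, mem_pinnedOpen]
    constructor
    · rintro ⟨heF, h⟩
      exact ⟨heF, fun h' => h (Or.inr h')⟩
    · rintro ⟨heF, h⟩
      exact ⟨heF, fun h' => h'.elim (fun h'' => h''.1 heF) h⟩
  have h2 : ofSet (pinnedOpen F z ∪ (F \ (pinnedOpen F z ∪ freeOf F y))) =
      A3InactiveTyped.flipOn F y := by
    rw [h3, ← flipOn_ofSet F z (freeOf_subset F y), h1]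
  rw [TB14Cut.iL_eq_ite', TB14Cut.iL_eq_ite']
  simp only [Set.indicator, Set.mem_setOf_eq, h1, h2, Pi.one_apply]
  by_cases hb : Conn ends y a b <;> by_cases hx : Conn ends (A3InactiveTyped.flipOn F y) a x <;>
    simp [hb, hx]

/-- **Typed Harris with a decreasing spectator on the second copy** (THEOREM): for a root `a` and
vertices `b, c, x`, `#{y : b ∈ C_y(a), x ∉ C_ȳ(a), c ∈ C_ȳ(a)} ≤ #{y : b ∈ C_y(a), x ∉ C_ȳ(a),
c ∈ C_y(a)}` at every profile — the half `H2` of the candidate lemma (MID). -/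
theorem pairCount_half_second_copy (ends : E → Sym2 V) (a b c x : V) (F : Finset E)
    (z : Config E) :
    pairCount F z (fun y w => iL ends a b y * (1 - iL ends a x w) * iL ends a c w :
        Config E → Config E → R) ≤
      pairCount F z (fun y w => iL ends a b y * (1 - iL ends a x w) * iL ends a c y) := by
  have h := pairCount_harris_cross (R := R) F z
    {X : Finset E | Conn ends (ofSet X) a b ∧
      ¬ Conn ends (ofSet (pinnedOpen F z ∪ (F \ X))) a x}
    (isUpperSet_cross ends a b x F z) (connEvent ends a c) (isUpperSet_connEvent ends a c)
  unfold pairCount at h ⊢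
  refine le_of_le_of_eq (le_of_eq_of_le ?_ h) ?_
  · refine Finset.sum_congr rfl fun y _ => ?_
    by_cases hy : ∀ e, e ∉ F → y e = z e
    · rw [if_pos hy, if_pos hy]
      beta_reduce
      rw [indicator_cross_eq ends a b x F z y hy]
      rfl
    · rw [if_neg hy, if_neg hy]
  · refine Finset.sum_congr rfl fun y _ => ?_
    by_cases hy : ∀ e, e ∉ F → y e = z e
    · rw [if_pos hy, if_pos hy]
      beta_reduce
      rw [indicator_cross_eq ends a b x F z y hy]
      rfl
    · rw [if_neg hy, if_neg hy]

end Cross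

end PairHarris

end Summit.Ventures.PercRepro2
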